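import Mathlib
import Literature.MathematicalPhysics.QuantumFieldTheory.Luscher2010.TrivializingMaps
import Literature.MathematicalPhysics.QuantumFieldTheory.Luscher2010.FlowActionSeries
import Summits.Ventures.LatticeQCDFlow.TrivializingMaps.TruncationDefect
import Summits.Ventures.LatticeQCDFlow.TrivializingMaps.UniformRadius
import Summits.Ventures.LatticeQCDFlow.TrivializingMaps.WilsonPolynomials
import Summits.Ventures.LatticeQCDFlow.TrivializingMaps.ExtensiveDefectReduction
import HarnessLib

/-!
# Volume-uniform bound on the link gradients of the Wilson action

HONEST FRAMING: exact (Metropolis-corrected) sampling algorithms for lattice gauge theory; figures of merit are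
autocorrelation/cost numbers at stated couplings and volumes; no continuum-physics claim.

Input (W) of `ExtensiveDefectReduction.extensiveDefect_of`: there is `c_W = c_W(d, n)` with
`|∂_{e,Y} S_W(ιU)| ≤ c_W` for every periodic lattice `(ℤ/L)^d`, link `e`, direction `Y` with `‖Y‖_F ≤ 1` and
`U ∈ SU(n)^E` (`wilsonGradBound`). No matrix-derivative formula is needed: every plaquette `Re tr(1 - U_p)` is the
FIXED smooth function `refPlaq : M_n(ℂ)^4 → ℝ` of its four links composed with a coordinate projection
(`plaqRe_eq_comp`), so by the chain rule its link derivative at `ιU` is `D refPlaq(A)[v]` with `A ∈ SU(n)^4` (a compact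
set on which `‖D refPlaq‖` is bounded, `exists_bound_fderiv_refPlaq`) and `‖v‖ ≤ ‖Y U_e‖_F ≤ n`; at most `4d²`
plaquettes contain a given link (`ExtensiveDefectReduction.abs_sum_plaq_le`). Reference: M. Lüscher, CMP 293 (2010)
899 [Luscher2010Trivializing, arXiv:0907.5491], §4.3–4.5 (locality and volume-independence of the expansion).
-/

namespace Summit.Ventures.LatticeQCDFlow.TrivializingMaps

open Literature.MathematicalPhysics.QuantumFieldTheory
open Literature.MathematicalPhysics.QuantumFieldTheory.Luscher2010
open scoped Matrix Matrix.Norms.Frobenius ContDiff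

noncomputable section

variable {d L n : ℕ}

/-! ## §1. The reference plaquette function on four free links -/

/-- `refPlaq(A) = Re tr(1 - A₀ A₁ A₂ᴴ A₃ᴴ)` on `M_n(ℂ)^4`: the plaquette as a function of its four links.
[cite: Luscher2010Trivializing, §4.4 eq. (4.16)] -/
def refPlaq (n : ℕ) (A : Fin 4 → Matrix (Fin n) (Fin n) ℂ) : ℝ :=
  ((1 : Matrix (Fin n) (Fin n) ℂ) - A 0 * A 1 * (A 2)ᴴ * (A 3)ᴴ).trace.re

/-- `refPlaq` is smooth (a polynomial). [folklore] -/
theorem contDiff_refPlaq {m : WithTop ℕ∞} : ContDiff ℝ m (refPlaq n) := by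
  have hprod : ContDiff ℝ m (fun A : Fin 4 → Matrix (Fin n) (Fin n) ℂ => A 0 * A 1 * (A 2)ᴴ * (A 3)ᴴ) :=
    (((contDiff_apply ℝ (Matrix (Fin n) (Fin n) ℂ) (0 : Fin 4)).mul
      (contDiff_apply ℝ (Matrix (Fin n) (Fin n) ℂ) (1 : Fin 4))).mul
      (WilsonFlow.contDiff_conjTranspose.comp (contDiff_apply ℝ (Matrix (Fin n) (Fin n) ℂ) (2 : Fin 4)))).mul
      (WilsonFlow.contDiff_conjTranspose.comp (contDiff_apply ℝ (Matrix (Fin n) (Fin n) ℂ) (3 : Fin 4)))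
  exact Complex.reCLM.contDiff.comp ((WilsonFlow.contDiff_trace (n := n)).comp (contDiff_const.sub hprod))

/-- **`D refPlaq(A)[v]` is bounded for `A ∈ SU(n)^4`, `‖v‖ ≤ n`** (a continuous function on a compact set).
[folklore] -/
theorem exists_bound_fderiv_refPlaq : ∃ K : ℝ, 0 ≤ K ∧ ∀ A v : Fin 4 → Matrix (Fin n) (Fin n) ℂ,
    (∀ i, A i ∈ Set.range (Subtype.val : ↥(Matrix.specialUnitaryGroup (Fin n) ℂ) → Matrix (Fin n) (Fin n) ℂ)) →
      ‖v‖ ≤ n → |fderiv ℝ (refPlaq n) A v| ≤ K := by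
  haveI : ProperSpace (Fin 4 → Matrix (Fin n) (Fin n) ℂ) := FiniteDimensional.proper ℝ _
  have hC : IsCompact ((Set.pi Set.univ fun _ : Fin 4 =>
      Set.range (Subtype.val : ↥(Matrix.specialUnitaryGroup (Fin n) ℂ) → Matrix (Fin n) (Fin n) ℂ)) ×ˢ
      Metric.closedBall (0 : Fin 4 → Matrix (Fin n) (Fin n) ℂ) n) :=
    (isCompact_univ_pi fun _ => isCompact_range continuous_subtype_val).prod (isCompact_closedBall _ _)
  have hcont : Continuous fun q : (Fin 4 → Matrix (Fin n) (Fin n) ℂ) × (Fin 4 → Matrix (Fin n) (Fin n) ℂ) =>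
      fderiv ℝ (refPlaq n) q.1 q.2 :=
    (((contDiff_refPlaq (m := 1)).continuous_fderiv one_ne_zero).comp continuous_fst).clm_apply continuous_snd
  obtain ⟨K, hK⟩ := hC.exists_bound_of_continuousOn hcont.continuousOn
  refine ⟨max K 0, le_max_right _ _, fun A v hA hv => ?_⟩
  have h := hK (A, v) (Set.mk_mem_prod (Set.mem_univ_pi.2 hA) (by simpa using hv))
  rw [Real.norm_eq_abs] at h
  exact h.trans (le_max_left _ _)

/-- A special unitary matrix has Frobenius norm `≤ n` (entries bounded by one). [folklore] -/
theorem norm_coe_specialUnitary_le (u : ↥(Matrix.specialUnitaryGroup (Fin n) ℂ)) :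
    ‖(u : Matrix (Fin n) (Fin n) ℂ)‖ ≤ n := by
  have h1 : ‖(u : Matrix (Fin n) (Fin n) ℂ)‖ ^ 2 ≤ (n : ℝ) ^ 2 := by
    rw [WilsonFlow.frobenius_norm_sq]
    calc ∑ i, ∑ j, ‖(u : Matrix (Fin n) (Fin n) ℂ) i j‖ ^ 2 ≤ ∑ _i : Fin n, ∑ _j : Fin n, (1 : ℝ) :=
          Finset.sum_le_sum fun i _ => Finset.sum_le_sum fun j _ => by
            have h := entry_norm_bound_of_unitary u.2.1 i j
            nlinarith [norm_nonneg ((u : Matrix (Fin n) (Fin n) ℂ) i j)]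
      _ = (n : ℝ) ^ 2 := by simp; ring
  nlinarith [norm_nonneg (u : Matrix (Fin n) (Fin n) ℂ), Nat.cast_nonneg (α := ℝ) n]

/-! ## §2. Plaquettes factor through `refPlaq` -/

section Lattice

/-- The four links of the plaquette `(x; μ, ν)`, as a `Fin 4`-indexed family. [folklore] -/
def plaqIdx (x : Site d L) (μ ν : Fin d) : Fin 4 → Edge d L := ![(x, μ), (x.shift μ, ν), (x.shift ν, μ), (x, ν)]

/-- The coordinate projection `W ↦ (W_{l_0}, …, W_{l_3})` onto the links of a plaquette (a continuous linear
map). [folklore] -/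
def plaqProj (x : Site d L) (μ ν : Fin d) : AmbConfig d L n →L[ℝ] (Fin 4 → Matrix (Fin n) (Fin n) ℂ) :=
  ContinuousLinearMap.pi fun i =>
    ContinuousLinearMap.proj (R := ℝ) (φ := fun _ : Edge d L => Matrix (Fin n) (Fin n) ℂ) (plaqIdx x μ ν i)

/-- Components of `plaqProj`. [folklore] -/
@[simp] theorem plaqProj_apply (x : Site d L) (μ ν : Fin d) (W : AmbConfig d L n) (i : Fin 4) :
    plaqProj x μ ν W i = W (plaqIdx x μ ν i) := rfl

/-- **Every plaquette is `refPlaq` of its four links.** [cite: Luscher2010Trivializing, §4.4 eq. (4.16)] -/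
theorem plaqRe_eq_comp (x : Site d L) (μ ν : Fin d) :
    plaqRe (n := n) x μ ν = refPlaq n ∘ plaqProj x μ ν := by
  funext W
  simp [plaqRe, refPlaq, plaqIdx]

variable [NeZero L]

/-- **Uniform bound on plaquette link derivatives**: `|∂_{e,Y} Re tr(1 - U_p)| ≤ K` at special-unitary
configurations, for `‖Y‖_F ≤ 1`, with `K` the bound of `exists_bound_fderiv_refPlaq` — independent of the lattice.
[cite: Luscher2010Trivializing, §4.3] -/
theorem abs_linkDeriv_plaqRe_le {K : ℝ}
    (hK : ∀ A v : Fin 4 → Matrix (Fin n) (Fin n) ℂ,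
      (∀ i, A i ∈ Set.range (Subtype.val : ↥(Matrix.specialUnitaryGroup (Fin n) ℂ) → Matrix (Fin n) (Fin n) ℂ)) →
        ‖v‖ ≤ n → |fderiv ℝ (refPlaq n) A v| ≤ K)
    (x : Site d L) (μ ν : Fin d) (e : Edge d L) {Y : Matrix (Fin n) (Fin n) ℂ} (hY : ‖Y‖ ≤ 1)
    (U : GaugeConfig d L ↥(Matrix.specialUnitaryGroup (Fin n) ℂ)) :
    |linkDeriv e Y (plaqRe x μ ν) (WilsonFlow.coeConfig U)| ≤ K := by
  rw [plaqRe_eq_comp]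
  have hQ : DifferentiableAt ℝ (refPlaq n) (plaqProj x μ ν (WilsonFlow.coeConfig U)) :=
    (contDiff_refPlaq (m := 1)).differentiable one_ne_zero _
  -- (the derivative is stated over the coercion `⇑(plaqProj …)` as written, so that the rewrite below matches)
  have hd : HasFDerivAt (refPlaq n ∘ ⇑(plaqProj (n := n) x μ ν))
      ((fderiv ℝ (refPlaq n) (plaqProj x μ ν (WilsonFlow.coeConfig U))).comp (plaqProj x μ ν))
      (WilsonFlow.coeConfig U) :=
    hQ.hasFDerivAt.comp _ (plaqProj x μ ν).hasFDerivAt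
  rw [linkDeriv_eq_fderiv hd.differentiableAt, hd.fderiv, ContinuousLinearMap.comp_apply]
  refine hK _ _ (fun i => ⟨U (plaqIdx x μ ν i), rfl⟩) ?_
  refine (pi_norm_le_iff_of_nonneg (Nat.cast_nonneg n)).2 fun i => ?_
  rw [plaqProj_apply, Pi.single_apply]
  split_ifs with h
  · calc ‖Y * WilsonFlow.coeConfig U e‖ ≤ ‖Y‖ * ‖WilsonFlow.coeConfig U e‖ := norm_mul_le _ _
      _ ≤ 1 * n := mul_le_mul hY (norm_coe_specialUnitary_le (U e)) (norm_nonneg _) zero_le_one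
      _ = n := one_mul _
  · rw [norm_zero]; exact Nat.cast_nonneg n

/-! ## §3. The Wilson action -/

/-- The `(x; μ, ν)` term of the Wilson action (zero unless `μ < ν`). [folklore] -/
def plaqTerm (p : Site d L × Fin d × Fin d) : AmbConfig d L n → ℝ :=
  fun W => if p.2.1 < p.2.2 then plaqRe p.1 p.2.1 p.2.2 W else 0

omit [NeZero L] in
/-- `plaqTerm p = plaqRe …` when `μ < ν`. [folklore] -/
theorem plaqTerm_of_lt {p : Site d L × Fin d × Fin d} (h : p.2.1 < p.2.2) :
    plaqTerm (n := n) p = plaqRe p.1 p.2.1 p.2.2 := by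
  funext W; simp [plaqTerm, h]

omit [NeZero L] in
/-- `plaqTerm p = 0` when `¬ μ < ν`. [folklore] -/
theorem plaqTerm_of_not_lt {p : Site d L × Fin d × Fin d} (h : ¬ p.2.1 < p.2.2) :
    plaqTerm (n := n) p = fun _ => 0 := by
  funext W; simp [plaqTerm, h]

/-- The Wilson action as a sum of `plaqTerm`s over `(x, μ, ν)`. [cite: Luscher2010Trivializing, §4.4 eq. (4.16)] -/
theorem ambWilsonAction_eq_sum_plaqTerm : (ambWilsonAction : AmbConfig d L n → ℝ) =
    fun W => ∑ p : Site d L × Fin d × Fin d, plaqTerm p W := by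
  funext W
  simp only [ambWilsonAction, plaqTerm, plaqRe, Fintype.sum_prod_type]

omit [NeZero L] in
/-- Link derivatives of constants vanish. [folklore] -/
theorem linkDeriv_const (e : Edge d L) (X : Matrix (Fin n) (Fin n) ℂ) (c : ℝ) :
    linkDeriv e X (fun _ : AmbConfig d L n => c) = fun _ => 0 := by
  funext W
  unfold linkDeriv
  exact deriv_const (0 : ℝ) c

/-- `plaqTerm p` is smooth. [folklore] -/
theorem contDiff_plaqTerm (p : Site d L × Fin d × Fin d) : ContDiff ℝ ∞ (plaqTerm (n := n) p) := by
  by_cases h : p.2.1 < p.2.2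
  · rw [plaqTerm_of_lt h]; exact contDiff_of_mem_PD (plaqRe_mem p.1 p.2.1 p.2.2)
  · rw [plaqTerm_of_not_lt h]; exact contDiff_const

end Lattice

/-- **Volume-uniform Wilson gradient bound** (input (W) of `extensiveDefect_of`): there is `c_W ≥ 0`, depending only
on `d` and `n`, with `|∂_{e,Y} S_W(ιU)| ≤ c_W` for all `L`, links `e`, `Y ∈ 𝔰𝔲(n)` with `‖Y‖_F ≤ 1` and
`U ∈ SU(n)^E`. [cite: Luscher2010Trivializing, §4.3–§4.5] -/
theorem wilsonGradBound (d n : ℕ) : ∃ cW : ℝ, 0 ≤ cW ∧ ∀ (L : ℕ) [NeZero L] (e : Edge d L)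
    (Y : Matrix (Fin n) (Fin n) ℂ), Y ∈ suAlgebra n → ‖Y‖ ≤ 1 →
      ∀ U : GaugeConfig d L ↥(Matrix.specialUnitaryGroup (Fin n) ℂ),
        |linkDeriv e Y (ambWilsonAction : AmbConfig d L n → ℝ) (WilsonFlow.coeConfig U)| ≤ cW := by
  obtain ⟨K, hK0, hK⟩ := exists_bound_fderiv_refPlaq (n := n)
  refine ⟨4 * (d * d) * K, by positivity, fun L _ e Y _ hY U => ?_⟩
  rw [ambWilsonAction_eq_sum_plaqTerm,
    linkDeriv_finset_sum e Y Finset.univ (fun p : Site d L × Fin d × Fin d => plaqTerm p)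
      (fun p _ => contDiff_plaqTerm p)]
  refine abs_sum_plaq_le e _ hK0 (fun p hp => ?_) (fun p => ?_)
  · by_cases h : p.2.1 < p.2.2
    · rw [plaqTerm_of_lt h, linkDeriv_eq_zero_of_not_mem Y (plaqRe_mem p.1 p.2.1 p.2.2).2 hp]
    · rw [plaqTerm_of_not_lt h, linkDeriv_const]
  · by_cases h : p.2.1 < p.2.2
    · rw [plaqTerm_of_lt h]; exact abs_linkDeriv_plaqRe_le hK _ _ _ e hY U
    · rw [plaqTerm_of_not_lt h, linkDeriv_const, abs_zero]; exact hK0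

end

end Summit.Ventures.LatticeQCDFlow.TrivializingMaps
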